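import Summits.ResolutionOfSingularities.ResolutionOfSingularities.Theorems.EquisingularLiftEquisingularLiftNatTowerVertexLevels
import Summits.ResolutionOfSingularities.ResolutionOfSingularities.Theorems.EquisingularLiftEquisingularLiftNatA5LevelTwo
import HarnessLib

/-!
# [OURS] `A_{2k+1}` HAS BLOW-UP DEPTH `k`: the origin of `Spec K[y₀,y₁,y₂]/(y₀y₁ + y₂^{2k+2})` has level `k` in EVERY blow-up tower, every field, every `k`
# — the first INFINITE FAMILY run through the all-levels marked engine ✓ `OneStep.towerLevel_succ_origin_marked` (`A_{2k+3} → A_{2k+1}` in chart `2`)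
# (cruxes `Theses.EquisingularLift.EquisingularLiftNat` / `…NatThree` / `EquisingularLift`, stmt-ResolutionOfSingularities-20038 / -20148 / -15660)

[OURS · leafhand-res-equisingularlift-12 g0, 2026-08-31; cell `pub/decomp-res`] AI-produced, weaker than expert review; NOT a statement of any manuscript;
nothing here proves resolution of singularities in positive characteristic.  DEF-FREE helper; no `sorry`; standard axioms; ZERO named hypotheses.

* `SecondOrderPoint.A_odd_strictTransform₂` — chart `2`: `f_{k+1}(T₂T₀, T₂T₁, T₂) = T₂²·f_k` for `f_k = y₀y₁ + y₂^{2k+2}`;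
* `SecondOrderPoint.A₁_node_oneStep` — one-step data for the node `y₀y₁ + y₂²` (+ `0 + 0`) (✓ `FirstOrderPoint.exists_strictTransform`, ✓ `firstOrder_node`);
* ★★★ `OneStep.towerLevel_origin_A_odd` — by induction on `k`: `∀ f = y₀y₁ + y₂^{2k+2}`, the origin of `Spec K[T]/(f)` has `D`-level `k` (base: the node is
  one-step, ✓ `towerLevel_zero_origin`; step: graph charts `0, 1` regular along `E` (✓ `A_charts_regular_off_origin₂`), chart `2` carries `f_k` at its origin
  — the only mark — with the induction hypothesis as payload).

Remaining (S): the vertex transport (chart block of ✓ `towerLevel_succ_vertex_marked` with an affine level statement as input) and `isoHypPoint_of_A_oddVertices`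
via ✓ `isoHypPoint_of_towerVertices`.  Honest label: closes no registered stub.

References: [Hartshorne1977, I Thm. 5.1, I Ex. 5.6, II Ex. 7.12]; [Lipman1969, §24]; [StacksProject, Tags 0804, 080E]; through the cited tree files.
-/

set_option linter.dupNamespace false -- mandated namespace `Summit.<Summit>.<Problem>` of this single-conjunct summit

noncomputable section

open CategoryTheory CategoryTheory.Limits AlgebraicGeometry TopologicalSpace Topology
open MvPolynomial
open Literature.AlgebraicGeometry.Resolution
open AlgebraicGeometry.Scheme.IdealSheafData

namespace Summit.ResolutionOfSingularities.ResolutionOfSingularities.Cruxes.EquisingularLiftNat.Sections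

namespace SecondOrderPoint

variable (K : Type) [Field K]

/-- `y₂^{n} ∈ (y)³` for `3 ≤ n`. [folklore] -/
theorem X_two_pow_mem_pow_three {n : ℕ} (hn : 3 ≤ n) :
    (X 2 ^ n : MvPolynomial (Fin 3) K) ∈ Ideal.span (Set.range (X : Fin 3 → MvPolynomial (Fin 3) K)) ^ 3 :=
  Ideal.pow_le_pow_right hn (Ideal.pow_mem_pow (Ideal.subset_span (Set.mem_range_self (2 : Fin 3))) n)

/-- **Chart `2` of `f_{k+1} = y₀y₁ + y₂^{2k+4}`**: `f_{k+1}(T₂T₀, T₂T₁, T₂) = T₂²·(T₀T₁ + T₂^{2k+2})`. [cite: Hartshorne1977, II Ex. 7.12] -/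
theorem A_odd_strictTransform₂ (k : ℕ) :
    aeval (fun j => X 2 * Function.update (X : Fin 3 → MvPolynomial (Fin 3) K) 2 1 j) (X 0 * X 1 + X 2 ^ (2 * k + 4) : MvPolynomial (Fin 3) K) =
      X 2 ^ 2 * (X 0 * X 1 + X 2 ^ (2 * k + 2)) := by
  rw [map_add, aeval_subst_X_mul_X_of_ne K 2 0 1 (by decide) (by decide), map_pow, aeval_X, Function.update_self]
  ring

/-- **One-step data for the node `y₀y₁ + y₂²`** (`Φ = y₀y₁ + y₂²`, `Ψ₁ = Ψ'' = 0`; ✓ `FirstOrderPoint.firstOrder_node`, every characteristic).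
[cite: Hartshorne1977, I Thm. 5.1, II Ex. 7.12] -/
theorem A₁_node_oneStep (l : Fin 3) :
    ∃ G : MvPolynomial (Fin 3) K,
      aeval (fun j => X l * Function.update (X : Fin 3 → MvPolynomial (Fin 3) K) l 1 j)
          ((X 0 * X 1 + X 2 ^ 2 : MvPolynomial (Fin 3) K) + 0) = X l ^ 2 * G ∧
      ∀ P : Ideal (MvPolynomial (Fin 3) K), P.IsPrime → (X l : MvPolynomial (Fin 3) K) ∈ P → G ∈ P → ∃ j, pderiv j G ∉ P := by
  obtain ⟨G, hG, hJ⟩ := A₃_exceptionalPoint_oneStep K l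
  refine ⟨G, ?_, hJ⟩
  rw [← hG, add_zero, add_zero, add_zero]

end SecondOrderPoint

namespace OneStep

variable (K : Type) [Field K]

/-- ★★★ **`A_{2k+1}` HAS LEVEL `k` IN EVERY BLOW-UP TOWER**: for every `k` and every `f = y₀y₁ + y₂^{2k+2}`, the origin of `Spec K[y]/(f)` has `D`-level `k`.
[OURS] [cite: Hartshorne1977, I Thm. 5.1, I Ex. 5.6] [cite: Lipman1969, §24] [cite: StacksProject, Tag 080E] -/
theorem towerLevel_origin_A_odd (D : ℕ → ∀ Γ : Scheme.{0}, Γ → Prop)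
    (hD0 : ∀ (Γ : Scheme.{0}) (y : Γ), IsClosed (({y} : Set Γ)) →
      (D 0 Γ y ↔ ∀ (hy : IsClosed (({y} : Set Γ))) (Z : Scheme.{0}) (τ : Z ⟶ Γ), IsBlowup τ (vanishingIdeal ⟨{y}, hy⟩) →
        ∀ z : Z, τ z = y → IsRegularLocalRing (Z.presheaf.stalk z)))
    (hDsucc : ∀ (d : ℕ) (Γ : Scheme.{0}) (y : Γ), IsClosed (({y} : Set Γ)) →
      (D (d + 1) Γ y ↔ ∀ (hy : IsClosed (({y} : Set Γ))) (Z : Scheme.{0}) (τ : Z ⟶ Γ), IsBlowup τ (vanishingIdeal ⟨{y}, hy⟩) →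
        ∃ S' : Finset Z, (∀ z : Z, τ z = y → z ∉ S' → IsRegularLocalRing (Z.presheaf.stalk z)) ∧
          ∀ z ∈ S', τ z = y ∧ IsClosed (({z} : Set Z)) ∧ ∃ d' ≤ d, D d' Z z)) (k : ℕ) :
    ∀ (f : MvPolynomial (Fin 3) K), f = X 0 * X 1 + X 2 ^ (2 * k + 2) →
      ∀ (y₀ : Spec (CommRingCat.of (MvPolynomial (Fin 3) K ⧸ Ideal.span {f}))),
        y₀.asIdeal = Ideal.map (Ideal.Quotient.mk (Ideal.span {f})) (Ideal.span (Set.range (X : Fin 3 → MvPolynomial (Fin 3) K))) →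
        D k (Spec (CommRingCat.of (MvPolynomial (Fin 3) K ⧸ Ideal.span {f}))) y₀ := by
  classical
  have hΦ : (X 0 * X 1 : MvPolynomial (Fin 3) K).IsHomogeneous 2 := by
    simpa using (isHomogeneous_X K (0 : Fin 3)).mul (isHomogeneous_X K (1 : Fin 3))
  have hΦ0 : (X 0 * X 1 : MvPolynomial (Fin 3) K) ≠ 0 := mul_ne_zero (X_ne_zero 0) (X_ne_zero 1)
  have hnode : (X 0 * X 1 + X 2 ^ 2 : MvPolynomial (Fin 3) K).IsHomogeneous 2 := by
    refine IsHomogeneous.add ?_ (isHomogeneous_X_pow 2 2)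
    simpa using (isHomogeneous_X K (0 : Fin 3)).mul (isHomogeneous_X K (1 : Fin 3))
  have hnode0 : (X 0 * X 1 + X 2 ^ 2 : MvPolynomial (Fin 3) K) ≠ 0 := by
    intro h
    have h1 := congrArg (eval (fun i : Fin 3 => if i = 2 then (1 : K) else 0)) h
    simp at h1
  induction k with
  | zero =>
    intro f hf y₀ hy₀
    -- the node: one-step, level `0`
    have e : (X 0 * X 1 + X 2 ^ 2 : MvPolynomial (Fin 3) K) + 0 = f := by rw [hf]; ring
    subst e
    exact towerLevel_zero_origin K D hD0 hDsucc (X 0 * X 1 + X 2 ^ 2) 0 (by norm_num) hnode hnode0 (Ideal.zero_mem _)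
      (SecondOrderPoint.A₁_node_oneStep K) y₀ hy₀
  | succ k ih =>
    intro f hf y₀ hy₀
    have e : (X 0 * X 1 : MvPolynomial (Fin 3) K) + X 2 ^ (2 * k + 4) = f := by rw [hf]; ring_nf
    subst e
    have hΨ : (X 2 ^ (2 * k + 4) : MvPolynomial (Fin 3) K) ∈ Ideal.span (Set.range (X : Fin 3 → MvPolynomial (Fin 3) K)) ^ (2 + 1) :=
      SecondOrderPoint.X_two_pow_mem_pow_three K (by omega)
    obtain ⟨⟨G₀, hG₀, hJ₀⟩, ⟨G₁, hG₁, hJ₁⟩, -⟩ := SecondOrderPoint.A_charts_regular_off_origin₂ K hΨ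
    have hG₂ := SecondOrderPoint.A_odd_strictTransform₂ K k
    have hG₂' : (X 0 * X 1 + X 2 ^ (2 * k + 2) : MvPolynomial (Fin 3) K) - X 0 * X 1 ∈ Ideal.span {(X 2 : MvPolynomial (Fin 3) K)} :=
      Ideal.mem_span_singleton'.mpr ⟨X 2 ^ (2 * k + 1), by ring⟩
    refine towerLevel_succ_origin_marked K D hD0 hDsucc k (X 0 * X 1) (X 2 ^ (2 * k + 4)) (by norm_num) hΦ hΦ0 hΨ
      ![G₀, G₁, X 0 * X 1 + X 2 ^ (2 * k + 2)] (fun a => ?_) ![∅, ∅, {(0 : Fin 3 → K)}] (fun a P hP haP hGP => ?_)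
      (fun a lam hlam _ => ?_) y₀ hy₀
    · fin_cases a
      · exact hG₀
      · exact hG₁
      · exact hG₂
    · fin_cases a
      · exact Or.inl (hJ₀ P hP haP)
      · exact Or.inl (hJ₁ P hP haP)
      · by_cases hall : ∀ j, pderiv j (X 0 * X 1 + X 2 ^ (2 * k + 2) : MvPolynomial (Fin 3) K) ∈ P
        · right
          refine ⟨0, Finset.mem_singleton_self _, fun i => ?_⟩
          simpa using SecondOrderPoint.forall_X_mem_of_sub_mul_mem_span₃ K hG₂' P haP (hall 0) (hall 1) i
        · left
          push Not at hall
          exact hall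
    · fin_cases a
      · simp at hlam
      · simp at hlam
      · have hlam0 : lam = 0 := by simpa using hlam
        subst hlam0
        have h0 : (fun i : Fin 3 => X i + C ((0 : Fin 3 → K) i)) = (X : Fin 3 → MvPolynomial (Fin 3) K) := by
          funext i; simp
        have htr : aeval (fun i : Fin 3 => X i + C ((0 : Fin 3 → K) i)) (X 0 * X 1 + X 2 ^ (2 * k + 2) : MvPolynomial (Fin 3) K) =
            X 0 * X 1 + X 2 ^ (2 * k + 2) := by
          simp only [h0, MvPolynomial.aeval_X_left, AlgHom.coe_id, id_eq]
        -- the payload: the induction hypothesis at the translate `f_k`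
        rcases Nat.eq_zero_or_pos k with hk | hk
        · subst hk
          refine ⟨2, X 0 * X 1 + X 2 ^ 2, 0, by norm_num, ?_, Ideal.zero_mem _, ?_, fun y' hy' => ⟨0, le_rfl, ?_⟩⟩
          · simpa using hnode
          · change aeval (fun i : Fin 3 => X i + C ((0 : Fin 3 → K) i)) (X 0 * X 1 + X 2 ^ (2 * 0 + 2) : MvPolynomial (Fin 3) K) = _
            rw [htr]; ring
          · exact ih ((X 0 * X 1 + X 2 ^ 2 : MvPolynomial (Fin 3) K) + 0) (by ring) y' hy'
        · refine ⟨2, X 0 * X 1, X 2 ^ (2 * k + 2), by norm_num, hΦ, SecondOrderPoint.X_two_pow_mem_pow_three K (by omega), htr,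
            fun y' hy' => ⟨k, le_rfl, ?_⟩⟩
          exact ih (X 0 * X 1 + X 2 ^ (2 * k + 2)) rfl y' hy'

end OneStep

end Summit.ResolutionOfSingularities.ResolutionOfSingularities.Cruxes.EquisingularLiftNat.Sections

end
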